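import Mathlib.RepresentationTheory.Coinvariants
import Mathlib.RepresentationTheory.Intertwining
import Mathlib.RepresentationTheory.Irreducible
import Mathlib.LinearAlgebra.Matrix.Reindex
import Mathlib.Topology.Instances.Matrix
import Literature.NumberTheory.Automorphic.SmoothInduction
import Literature.NumberTheory.Automorphic.JacquetModule
import Literature.NumberTheory.Automorphic.ParabolicGL
import Literature.NumberTheory.Automorphic.IrreducibleClasses
import Literature.NumberTheory.Automorphic.MatrixCoefficients
import Literature.NumberTheory.Automorphic.SmoothRepresentation
import Literature.NumberTheory.GaloisRepresentations.LocalField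
import HarnessLib

-- provenance: harness21/H21/H21/Statements/Lang/ParabolicInduction.lean @ 056f2c6 (interim HEAD d8f2665); M5 mechanical rewrite
/-!
# Langlands family (`lang`): parabolic induction and Jacquet modules on `GL_n(F)`
(AutomorphicL trunk, outline §3, item `G25:LangParabolic`; statement **lang.S15**, supplement)

Let `F` be a non-archimedean local field and `G = GL_n(F)`. For an ordered partition
`n = n₁ + ⋯ + n_r`, encoded by a monotone surjection `c : Fin n → Fin r`, item I7
(`Literature.Prelude.AutomorphicL.ParabolicGL`) provides the standard parabolic `P_c = M_c U_c`, the
normalised parabolic induction functor `i_c = Representation.parabolicIndGL F c` from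
representations of `M_c ≅ Π_a GL_{n_a}(F)` to representations of `GL_n(F)`, the Jacquet functor
`r_c = Representation.jacquetGL F c` (`U_c`-coinvariants) and its normalised version
`Representation.normalizedJacquetGL F c`. This file records the basic theorems about them:

* **lang.S15** (supplement to the definitional target tagged in
  `Literature.Statements.Lang.PAdicReps`): `Lang.isSupercuspidal_iff_jacquetGL` — an irreducible smooth
  representation `π` of `GL_n(F)` is supercuspidal (matrix coefficients compactly supported
  modulo the centre, `Representation.IsSupercuspidal`) iff all its proper Jacquet modules
  vanish, `r_c π = 0` for every proper standard parabolic `P_c` (Harish-Chandra 1970;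
  Casselman 1995, Thm. 5.3.1; Renard 2010, VI.2.1; Bushnell–Henniart 2006, §10.1 for `n = 2`).
* untagged known theorems: `Lang.frobenius_reciprocity_gl` (Frobenius reciprocity
  `Hom_G(π, i_c σ) ≃ Hom_M(r̄_c π, σ)`, Bernstein–Zelevinsky 1977, Prop. 1.9(b); the `GL_n`
  instance of `Representation.frobenius_normalizedInd` of item I6, with no modulus hypothesis
  since `δ_{P_c}` is trivial on the unipotent radical `U_c`), `Lang.jacquetGL_isAdmissible`
  (the Jacquet module of an *irreducible smooth* representation of `GL_n(F)` is admissible: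
  Jacquet's lemma `Representation.isAdmissible_jacquetGL` combined with Jacquet's admissibility
  theorem lang.S16, whose tag stays with `Literature.Statements.Lang.PAdicReps`; this is the proof
  route of lang.S16 in Bernstein–Zelevinsky 1976, §3), `Lang.bernsteinZelevinsky_support`
  (every irreducible smooth `π` embeds into some `i_c σ` with `σ` irreducible supercuspidal,
  Bernstein–Zelevinsky 1977, Thm. 2.5 and Cor. 2.13(c); Casselman 1995, Thm. 5.1.2 with 6.3.7) and
  `Lang.bernsteinZelevinsky_support_unique` (the pair `(c, σ)` is unique up to association,
  Bernstein–Zelevinsky 1977, Thm. 2.9).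
* the small amount of glue they need: `Literature.NumberTheory.Automorphic.isClosed_standardParabolicGL` and the instance
  `LocallyCompactSpace ↥(standardParabolicGL F c)` (so that the instance hypothesis of
  `parabolicIndGL` in item I7 is discharged over a local field), and `Lang.blockPermIso`, the
  isomorphism `Π_a GL_{n_a}(F) ≃* Π_b GL_{n'_b}(F)` induced by a bijection of blocks
  (used to express "association" of cuspidal data).

The irreducibility criterion for `i_c σ` with generic inducing data (Bernstein–Zelevinsky 1977,
Thm. 4.2) is deliberately omitted (outline §3).

## Mathlib declarations used rather than redefined

`Representation.Coinvariants`, `Representation.IntertwiningMap`, `Representation.Equiv`,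
`Representation.IsIrreducible`, `Matrix.GeneralLinearGroup` (`GL`), `Matrix.reindexAlgEquiv`,
`Units.mapEquiv`, `MulEquiv.piCongrRight`, `Equiv.piCongrLeft`,
`isClosed_setOf_blockTriangular`, `Units.continuous_val`, the instance
`LocallyCompactSpace αˣ` (`Mathlib.Topology.Algebra.Group.Basic`) and
`IsClosed.locallyCompactSpace`. Mathlib has no parabolic induction, Jacquet modules or
supercuspidal representations (grep `Jacquet`, `parabolic`, `supercuspidal` in
`Mathlib/RepresentationTheory`: nothing); those come from H21 items G19, I5–I7.

## Design notes

* `namespace Literature.Lang` for the statements (outline §3); the two topological glue declarations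
  live in `namespace Literature` next to `standardParabolicGL`.
* The vanishing of the Jacquet module `r_c π` is expressed as
  `Subsingleton (restrictUnipotentGL F c π).Coinvariants`, literally the carrier of
  `Representation.jacquetGL F c π` (item I7); this is the same space as the coinvariants of
  `π.comp (unipotentRadicalGL F c).subtype` since `unipotentRadicalGL = map subtype
  unipotentRadicalP` (`Literature.NumberTheory.Automorphic.unipotentRadicalGL_subgroupOf`).
* Proper standard parabolics of `GL_n` are indexed by monotone `c : Fin n → Fin r` with
  `Literature.IsProperBlocks c` (`c` surjective and `2 ≤ r`); for `n ≤ 1` there are none and both sides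
  of lang.S15 hold (every irreducible representation of the compact-mod-centre groups
  `GL_0, GL_1` is supercuspidal), so no vacuity issue arises.
* In `bernsteinZelevinsky_support` the inducing space `W` is quantified in the universe of `F`
  (the natural models are spaces of functions on `GL_{n_a}(F)`), and the cuspidal datum is a
  representation `σ` of the product group `Π_a GL_{n_a}(F)` which is irreducible, smooth and
  supercuspidal (for a finite product this is the same as an external tensor product of
  irreducible supercuspidal representations of the factors). "Association" of two data
  `(c, σ)`, `(c', σ')` is a bijection of blocks `w` with bijections of the index sets of matched
  blocks, and an isomorphism `σ ≅ σ' ∘ blockPermIso w e`; reindexing a block by a non-monotone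
  bijection changes `σ_a` by an inner automorphism only, so no monotonicity is imposed on `e`.

## References

* Harish-Chandra, *Harmonic analysis on reductive `p`-adic groups* (notes by van Dijk), LNM 162
  (1970).
* I. N. Bernstein, A. V. Zelevinsky, *Representations of the group `GL(n, F)` where `F` is a
  non-archimedean local field*, Russian Math. Surveys 31 (1976), §3.
* I. N. Bernstein, A. V. Zelevinsky, *Induced representations of reductive `p`-adic groups I*,
  Ann. Sci. ÉNS 10 (1977), Prop. 1.9, Thm. 2.5, Thm. 2.9, Cor. 2.13.
* W. Casselman, *Introduction to the theory of admissible representations of `p`-adic reductive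
  groups* (1995 notes), Thm. 3.2.4, Thm. 3.3.1, Thm. 5.1.2, Thm. 5.3.1, §6.3.
* D. Renard, *Représentations des groupes réductifs `p`-adiques*, Cours Spécialisés 17 (2010),
  VI.2.1–VI.2.2.
* C. J. Bushnell, G. Henniart, *The local Langlands conjecture for `GL(2)`* (2006), §§9–10.
-/

noncomputable section

open scoped MatrixGroups

universe u

/-! ### Topological glue: `P_c` is closed, hence locally compact -/

namespace Literature.NumberTheory.Automorphic

variable (F : Type*) [Field F] [ValuativeRel F] [TopologicalSpace F] [IsNonarchimedeanLocalField F]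
  {n : Type*} [Fintype n] [DecidableEq n] {α : Type*} [LinearOrder α] (c : n → α)

/-- The standard parabolic subgroup `P_c ≤ GL_n(F)` is closed: it is the preimage under the
(continuous) coercion `GL_n(F) → M_n(F)` of the closed set of block triangular matrices
(Mathlib `isClosed_setOf_blockTriangular`; `F` is Hausdorff by
`Literature.NumberTheory.GaloisRepresentations.IsNonarchimedeanLocalField.isLocalField`). (Bernstein–Zelevinsky 1977, §2.1.) [cite: BernsteinZelevinsky1977, §2.1] -/
theorem isClosed_standardParabolicGL : IsClosed (standardParabolicGL F c : Set (GL n F)) :=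
  haveI := (GaloisRepresentations.IsNonarchimedeanLocalField.isLocalField F).toT2Space
  (isClosed_setOf_blockTriangular (b := c)).preimage Units.continuous_val

/-- Over a non-archimedean local field `F` the standard parabolic `P_c ≤ GL_n(F)` is locally
compact (a closed subgroup of the locally compact group `GL_n(F) = (M_n(F))ˣ`). This discharges
the instance hypothesis `[LocallyCompactSpace ↥(standardParabolicGL F c)]` of
`Representation.parabolicIndGL` (item I7); it duplicates no Mathlib instance.
(Bernstein–Zelevinsky 1976, §1.1; Casselman 1995, §1.) [cite: BernsteinZelevinsky1976, §1.1] -/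
instance instLocallyCompactSpaceStandardParabolicGL :
    LocallyCompactSpace (standardParabolicGL F c) :=
  haveI := (GaloisRepresentations.IsNonarchimedeanLocalField.isLocalField F).toT2Space
  haveI : LocallyCompactSpace (Matrix n n F) := inferInstanceAs (LocallyCompactSpace (n → n → F))
  (isClosed_standardParabolicGL F c).locallyCompactSpace

end Literature.NumberTheory.Automorphic

namespace Literature.NumberTheory.Automorphic

open Representation

variable (F : Type u) [Field F]

/-! ### lang.S15 (supplement): supercuspidal = all proper Jacquet modules vanish -/

section S15

variable [ValuativeRel F] [TopologicalSpace F] [IsNonarchimedeanLocalField F] {n : ℕ} {V : Type*} [AddCommGroup V] [Module ℂ V]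

/-- **lang.S15** (supplement; Harish-Chandra 1970; Casselman 1995, Thm. 5.3.1; Renard 2010,
VI.2.1; Bushnell–Henniart 2006, §10.1 for `n = 2`; Bernstein–Zelevinsky 1976, §3.21).
**Harish-Chandra's criterion.** An irreducible smooth complex representation `π` of `GL_n(F)`,
`F` a non-archimedean local field, is **supercuspidal** (every smooth matrix coefficient is
compactly supported modulo the centre, `Representation.IsSupercuspidal`, item G19) if and only
if all its proper Jacquet modules vanish: for every proper standard parabolic `P_c`
(`c : Fin n → Fin r` monotone, surjective, `2 ≤ r`, i.e. `Literature.IsProperBlocks c`) the space of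
`U_c`-coinvariants `r_c π = V / ⟨π(u) v - v : u ∈ U_c⟩` (the carrier of
`Representation.jacquetGL F c π`, item I7) is zero. [cite: HarishChandra1970] -/
def isSupercuspidal_iff_jacquetGL : Prop :=
  ∀ (π : Representation ℂ (GL (Fin n) F) V) [π.IsIrreducible] (hπ : π.IsSmooth),
    π.IsSupercuspidal ↔ ∀ (r : ℕ) (c : Fin n → Fin r), IsProperBlocks c → Monotone c →
      Subsingleton (restrictUnipotentGL F c π).Coinvariants

end S15

/-! ### Frobenius reciprocity and Jacquet's lemma on `GL_n(F)` -/

section Frobenius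

variable [ValuativeRel F] [TopologicalSpace F] [IsNonarchimedeanLocalField F] {n : Type*} [Fintype n] [DecidableEq n] {α : Type*} [LinearOrder α] [Fintype α]
  (c : n → α) {V W : Type*} [AddCommGroup V] [Module ℂ V] [AddCommGroup W] [Module ℂ W]

/-- **Frobenius reciprocity for `GL_n(F)`** (Bernstein–Zelevinsky 1977, Prop. 1.9(b);
Casselman 1995, Thm. 3.2.4). For a smooth representation `π` of `GL_n(F)` and any
representation `σ` of the standard Levi `Π_a GL_{n_a}(F)`, restriction to `P_c` followed by
evaluation at `1` induces a linear isomorphism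
`Hom_{GL_n(F)} (π, i_c σ) ≃ₗ[ℂ] Hom_{Π GL_{n_a}(F)} (r̄_c π, σ)` between intertwining spaces,
where `i_c = parabolicIndGL F c` is normalised induction and `r̄_c = normalizedJacquetGL F c`
the normalised Jacquet functor. This is the `GL_n` instance of
`Representation.frobenius_normalizedInd` (item I6); its modulus hypothesis is automatic here
because `δ_{P_c}` is trivial on the unipotent radical `U_c` (a union of compact subgroups). [cite: BernsteinZelevinsky1977, Prop. 1.9(b] -/
def frobenius_reciprocity_gl : Prop :=
  ∀ (π : Representation ℂ (GL n F) V) (hπ : π.IsSmooth) (σ : Representation ℂ (Π a, GL {i // c i = a} F) W),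
    Nonempty (π.IntertwiningMap (parabolicIndGL F c σ) ≃ₗ[ℂ]
      (normalizedJacquetGL F c π).IntertwiningMap σ)

end Frobenius

section JacquetAdmissible

/-- **Jacquet modules of irreducible representations of `GL_n(F)` are admissible**
(Jacquet 1975; Bernstein–Zelevinsky 1976, §3.17 and Thm. 3.25; Bernstein–Zelevinsky 1977,
Thm. 2.5 with Prop. 2.3 (e); Casselman 1995, Thm. 3.3.1; Renard 2010, VI.2.2). For an
irreducible smooth representation `π` of `GL_n(F)`, `F` a non-archimedean local field, and every
standard parabolic `P_c`, the Jacquet module `r_c π` (item I7 `Representation.jacquetGL`) is an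
admissible representation of `Π_a GL_{n_a}(F)`. This combines Jacquet's lemma
(`Representation.isAdmissible_jacquetGL`: `r_c` preserves admissibility) with Jacquet's
admissibility theorem **lang.S16** (every irreducible smooth `π` is admissible; tagged in
`Literature.Statements.Lang.PAdicReps`), and is the key step of the Bernstein–Zelevinsky proof route
of lang.S16 (induction on `n` via the supercuspidal support).

Statement repair (2026-08-15; same name, same cite, same body). The earlier form of this constant
took its hypotheses on `F` from the instance variables of `section Frobenius`; since a `def`
absorbs only the section variables its body uses, `[ValuativeRel F] [IsNonarchimedeanLocalField F]`
were silently dropped and the constant quantified over a field `F` with an *arbitrary* topology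
(it elaborated as `(F : Type u) → [Field F] → [TopologicalSpace F] → … → (c : n → α) → {V : Type _} →
… → Prop`). That closed statement is not the cited theorem and is false: take `F = ℂ` with the
discrete topology and `n = Fin 1`, so that `U_c = 1` and `r_c π` is `π` itself; the group
`GL₁(ℂ) = ℂˣ` has irreducible complex representations of infinite dimension — the field
`L = ℂ(t)((t - a)^{1/m} : a ∈ ℂ, m ≥ 1)` is the `ℂ`-span of the divisible group
`Γ = ℂˣ · ⟨(t - a)^{1/m}⟩ ≅ μ_∞ ⊕ ℚ^{(𝔠)} ≅ ℂˣ`, hence a simple `ℂ[ℂˣ]`-module of dimension `𝔠` —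
and such a representation is smooth for the discrete topology but, `{1}` being compact open, not
admissible. Here the hypotheses on `F` are explicit binders of the definition (outside
`section Frobenius`), so none can be dropped: the constant now reads
`(F : Type u) → [Field F] → [ValuativeRel F] → [TopologicalSpace F] → [IsNonarchimedeanLocalField F] →
… → Prop`, the same repair as `Representation.isAdmissible_jacquetGL` (file `ParabolicGL`) and
`Representation.isAdmissible_jacquetModule_of_charZero` (file `JacquetLemma`). No declaration used
the old constant. Proof route: Jacquet's lemma `Representation.isAdmissible_jacquetGL F c` applied
to the admissibility of `π` (lang.S16 `jacquetAdmissibility_gl F`, transported to the index type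
`n` and to the universe of `V`). [cite: Jacquet1975] -/
def jacquetGL_isAdmissible [ValuativeRel F] [TopologicalSpace F] [IsNonarchimedeanLocalField F]
    {n : Type*} [Fintype n] [DecidableEq n] {α : Type*} [LinearOrder α] [Fintype α] (c : n → α)
    {V : Type*} [AddCommGroup V] [Module ℂ V] : Prop :=
  ∀ (π : Representation ℂ (GL n F) V) [π.IsIrreducible] (hπ : π.IsSmooth),
    (jacquetGL F c π).IsAdmissible

end JacquetAdmissible

/-! ### The supercuspidal support (Bernstein–Zelevinsky) -/

section Support

variable {n : ℕ}

/-- The isomorphism of standard Levi subgroups `Π_a GL_{n_a}(F) ≃* Π_b GL_{n'_b}(F)` attached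
to a **bijection of blocks**: `w : Fin r' ≃ Fin r` matches the block `b` of `c'` with the block
`w b` of `c`, and `e b : {i // c i = w b} ≃ {j // c' j = b}` identifies their index sets; the
map sends `(m_a)_a` to `(reindex (e b) (m_{w b}))_b` (Mathlib `Equiv.piCongrLeft`,
`MulEquiv.piCongrRight`, `Matrix.reindexAlgEquiv`, `Units.mapEquiv`). Two cuspidal data are
*associate* when they differ by such an isomorphism (Bernstein–Zelevinsky 1977, §2.8). [cite: BernsteinZelevinsky1977, §2.8] -/
def blockPermIso {r r' : ℕ} {c : Fin n → Fin r} {c' : Fin n → Fin r'} (w : Fin r' ≃ Fin r)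
    (e : ∀ b, {i // c i = w b} ≃ {j // c' j = b}) :
    (Π a, GL {i // c i = a} F) ≃* Π b, GL {j // c' j = b} F :=
  ({ (Equiv.piCongrLeft (fun a => GL {i // c i = a} F) w).symm with
      map_mul' := fun _ _ => rfl } :
    (Π a, GL {i // c i = a} F) ≃* Π b, GL {i // c i = w b} F).trans
    (MulEquiv.piCongrRight fun b =>
      Units.mapEquiv (Matrix.reindexAlgEquiv F F (e b)).toMulEquiv)

/-- Entries of `blockPermIso`: the `b`-th block of the image of `m` is the `(w b)`-th block of
`m` reindexed along `e b`. [folklore] -/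
@[simp] lemma blockPermIso_apply_coe {r r' : ℕ} {c : Fin n → Fin r} {c' : Fin n → Fin r'}
    (w : Fin r' ≃ Fin r) (e : ∀ b, {i // c i = w b} ≃ {j // c' j = b})
    (m : Π a, GL {i // c i = a} F) (b : Fin r') (j j' : {j // c' j = b}) :
    ((blockPermIso F w e m b : GL {j // c' j = b} F) : Matrix _ _ F) j j' =
      ((m (w b) : GL {i // c i = w b} F) : Matrix _ _ F) ((e b).symm j) ((e b).symm j') :=
  rfl

variable [ValuativeRel F] [TopologicalSpace F] [IsNonarchimedeanLocalField F]
  {V : Type*} [AddCommGroup V] [Module ℂ V]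

/-- **The supercuspidal support, existence** (Bernstein–Zelevinsky 1977, Thm. 2.5 and
Cor. 2.13(c); Bernstein–Zelevinsky 1976, §3.19; Casselman 1995, Thm. 5.1.2 with Thm. 6.3.7).
Every irreducible smooth complex representation `π` of `GL_n(F)` embeds into a representation
parabolically induced from an irreducible supercuspidal one: there are an ordered partition
`n = n₁ + ⋯ + n_r` (a monotone surjection `c : Fin n → Fin r`), a complex vector space `W` and an
irreducible smooth supercuspidal representation `σ` of the standard Levi `Π_a GL_{n_a}(F)` on
`W`, together with an injective intertwining map `π ↪ i_c σ`
(`i_c = Representation.parabolicIndGL F c`, normalised induction). For `π` itself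
supercuspidal one may take `r = 1`, `σ = π`. [cite: BernsteinZelevinsky1977, Thm. 2.5 and Cor. 2.13(c] -/
def bernsteinZelevinsky_support : Prop :=
  ∀ (π : Representation ℂ (GL (Fin n) F) V) [π.IsIrreducible] (hπ : π.IsSmooth),
    ∃ (r : ℕ) (c : Fin n → Fin r) (_ : Monotone c) (_ : Function.Surjective c) (W : Type u)
      (_ : AddCommGroup W) (_ : Module ℂ W) (σ : Representation ℂ (Π a, GL {i // c i = a} F) W),
      σ.IsIrreducible ∧ σ.IsSmooth ∧ σ.IsSupercuspidal ∧
        ∃ f : π.IntertwiningMap (parabolicIndGL F c σ), Function.Injective f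

/-- **The supercuspidal support, uniqueness up to association** (Bernstein–Zelevinsky 1977,
Thm. 2.9; Bernstein–Zelevinsky 1976, Thm. 3.19(b); Casselman 1995, Thm. 6.3.11). If an
irreducible smooth representation `π` of `GL_n(F)` embeds into `i_c σ` and into `i_{c'} σ'`,
with `c : Fin n → Fin r`, `c' : Fin n → Fin r'` surjective block labellings and `σ`, `σ'`
irreducible smooth supercuspidal representations of the standard Levi subgroups
`Π_a GL_{n_a}(F)`, `Π_b GL_{n'_b}(F)`, then the cuspidal data `(c, σ)` and `(c', σ')` are
**associate**: there is a bijection of blocks `w : Fin r' ≃ Fin r` with `n_{w b} = n'_b`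
(bijections `e b` of the index sets) such that `σ ≅ σ' ∘ blockPermIso F w e`, i.e.
`σ_{w b} ≅ σ'_b` for all `b`. [cite: BernsteinZelevinsky1977, Thm. 2.9] -/
def bernsteinZelevinsky_support_unique : Prop :=
  ∀ (π : Representation ℂ (GL (Fin n) F) V) [π.IsIrreducible] (hπ : π.IsSmooth) {r r' : ℕ} {c : Fin n → Fin r} {c' : Fin n → Fin r'} (hc : Function.Surjective c) (hc' : Function.Surjective c') {W W' : Type*} [AddCommGroup W] [Module ℂ W] [AddCommGroup W'] [Module ℂ W'] (σ : Representation ℂ (Π a, GL {i // c i = a} F) W) [σ.IsIrreducible] (hσ : σ.IsSmooth) (hσc : σ.IsSupercuspidal) (σ' : Representation ℂ (Π b, GL {j // c' j = b} F) W') [σ'.IsIrreducible] (hσ' : σ'.IsSmooth) (hσ'c : σ'.IsSupercuspidal) (f : π.IntertwiningMap (parabolicIndGL F c σ)) (hf : Function.Injective f) (f' : π.IntertwiningMap (parabolicIndGL F c' σ')) (hf' : Function.Injective f'),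
    ∃ (w : Fin r' ≃ Fin r) (e : ∀ b, {i // c i = w b} ≃ {j // c' j = b}),
      Nonempty (σ.Equiv (σ'.comp (blockPermIso F w e).toMonoidHom))

end Support

end Literature.NumberTheory.Automorphic
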